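import Mathlib
import HarnessLib
import Summits.AtomisticToContinuum.Crystallization.Theorems.FrustratedLawDichotomyTwoShellRigidityLsFitReplayRat
import Summits.AtomisticToContinuum.Crystallization.Theorems.FrustratedLawDichotomyTwoShellRigidityLsFitCellsFcc

/-!
# Two-shell rigidity, slot 3 · ★ `SphericalLsFit (7/200) (1/100) fccKissingPattern probes26 (821 / 10000) (167 / 5000) (431 / 10000) (8 / 125)`

The braced ω-sub-leaf B-run of record (fcc; decomp-a2c census-1 g22): `checkAllF fccModel prmFcc fccCellsF = true` assembled from
the per-shard replays (fcc_runCellF_01, fcc_runCellF_04, fcc_runCellF_07, fcc_runCellF_10, fcc_runCellF_13, fcc_runCellF_14) and the chart coverage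
(`native_decide`), then the rational interface `sphericalLsFit_fcc_of_checkAllF'` of `…TwoShellRigidityLsFitReplayRat` (lens-3 g37) at
the dial (α, Ω, V₁, V₃) = (821 / 10000, 167 / 5000, 431 / 10000, 8 / 125) dominating the certified readings
(0.08134, 0.03339, 0.04302, 0.06392).  Consumer: `…lsEntryAt_fcc_of_sphericalLsFit(_braced)`.
-/

namespace Summit.AtomisticToContinuum.Crystallization.Theorems

namespace Rig

open Summit.AtomisticToContinuum.Crystallization.Theorems.FrustratedLawDichotomyTwoShellRigidityLsLedger
open Summit.AtomisticToContinuum.Crystallization.Theorems.FrustratedLawDichotomyTwoShellRigidityGaugedLadder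
open Literature.Geometry.DiscreteGeometry

/-- Both charts of the fcc fit run are covered. -/
theorem fcc_coversF :
    (coversChart (fccCellsF.map CellF.skel) true && coversChart (fccCellsF.map CellF.skel) false) = true := by
  native_decide

/-- ★ The fcc fit run of record passes `checkAllF`. -/
theorem fcc_checkAllF : checkAllF fccModel prmFcc fccCellsF = true := by
  have hc := fcc_coversF
  simp only [fccCellsF, List.map_append] at hc
  simp only [checkAllF, fccCellsF, List.map_append, List.all_append, hc, fcc_runCellF_01, fcc_runCellF_04, fcc_runCellF_07, fcc_runCellF_10, fcc_runCellF_13, fcc_runCellF_14,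
    Bool.and_self]

/-- ★ **`SphericalLsFit (7/200) (1/100) fccKissingPattern probes26 α Ω V₁ V₃`** at the dial of the B-run of record. -/
theorem sphericalLsFit_fcc :
    SphericalLsFit (7 / 200) (1 / 100) fccKissingPattern probes26 (821 / 10000) (167 / 5000) (431 / 10000) (8 / 125) :=
  sphericalLsFit_fcc_of_checkAllF' fcc_checkAllF rfl (by norm_num [SC, prmFcc]) (by norm_num) (by norm_num) (by norm_num) (by norm_num)
    (by norm_num) (by norm_num [SC, prmFcc]) (by norm_num [SC, prmFcc]) (by norm_num [SC, prmFcc]) (by norm_num [SC, prmFcc]) (by norm_num [SC, prmFcc])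
    (by norm_num [SC, prmFcc]) (by norm_num [SC, prmFcc]) (by norm_num [SC, prmFcc])

end Rig

end Summit.AtomisticToContinuum.Crystallization.Theorems
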